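import Literature.AnabelianGeometry.EtaleTheta.Discharge.Sec5Thm57FinalKnitV3
import Literature.AnabelianGeometry.EtaleTheta.Discharge.Sec5Prop24OfThetaSettingTower

/-!
# [EtTh] §5, Theorem 5.7 — FINAL KNIT v3 AT THE TOWER OF THE SETTING, with the anchor binder `hP24` SUPPLIED by the frozen FACT
# Cor. 2.18 (i) (F-0620) and `hYdd` a theorem (pp. 264, 285–286, 322, 329–331 / PDF pp. 38, 59–60, 96, 103–105)

Mochizuki, *The étale theta function and its Frobenioid-theoretic manifestations*, Publ. RIMS **45** (2009)
[cite: MochizukiEtTh2009, Thm 5.7 p.329–330 (PDF pp.103–104); Lem 5.8 p.331 (PDF p.105); Cor 2.18 (i) p.285–286 (PDF pp.59–60);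
Prop 2.4 p.264 (PDF p.38); §5 p.322 (PDF p.96)].  abc-iut cell, layer L2, node `EtTh:Thm5.7`; seat abc-iut-w5-d123 (gen 6), the SETTING
half of abc-iut-w6-d077's offer «Setting twins … else yours» (STATUS 2026-08-26T17:44:45Z) on the '_final_v3' closer of record
(`Sec5Thm57FinalKnitV3.lean`, p458453; abc-iut-L2-lead (gen 4) R527 «'_final_v3' INTERFACE = (r4) FINAL»).  PROOF-ONLY (0 definitions,
0 new named facts; nothing landed is edited or restated).

THE POINT.  `thetaRootPreservedAll_ofConnectedTemperoidYddFamily_final_v3` is stated for an arbitrary projective system of §2 data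
`𝒯 : ThetaEnvTower E` identified with `Π^tp_X̲̲` by `ιX`.  At the §1/§2 SETTING of record `(X, 𝒯, ιX) := (Π^tp_X̲̲, Cu.thetaEnvTower τ hC hS, id)`
(abc-iut-L2-t8's `TowerOfSetting.lean`; abc-iut-L2-t4's `ThetaFrobenioidTower.ofThetaSettingFamily`, which IS `ofConnectedTemperoidFamily`
there — `ofThetaSettingFamily_eq`, `rfl`) two of its displayed binders are THEOREMS of the tree:
* the anchor binder `hP24 : ∀ γ : Π^tp_X̲̲ ≃ₜ* Π^tp_X̲̲, γ(Π^tp_Ÿ̲̲) = Π^tp_Ÿ̲̲` («every topological automorphism of `Π^tp_X̲̲` stabilises `Π^tp_Ÿ̲̲`»,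
  Prop. 2.4 / Cor. 2.18 (i) class) IS the `Π^tp_Ÿ`-clause of abc-iut-L2-t2's frozen named FACT `RigidData.Cor218_i` (FACT-LIST F-0620) at
  abc-iut-L2-t8's §1 instantiation `Cu.rigidData μ' hC hS h15 L` — this seat's `Cu.hP24_thetaEnvTower_of_cor218_i` (p452318); and
* the input `hYdd` of the re-keyed `hfac₁` («`aug(Π^tp_Ÿ̲̲)` exhausts `aug(Π^tp_X̲̲)`», §5 p.322) is abc-iut-L2-t4's `hYdd_ofThetaSetting`, read
  for the tower — this seat's `hYdd_thetaEnvTower_ofThetaSetting` (p448710).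
RESULT `thetaRootPreservedAll_ofThetaSettingYddFamily_final_v3_of_cor218_i`: Thm. 5.7 (root level, all identifications) at every level of
the tower OF THE SETTING, MODULO exactly the binders of '_final_v3' with `hP24` and `hYdd` REPLACED by the FACT inputs `h218i` (F-0620),
`h15iii` (`Prop15iii`, F-0591) and the cusp labels `L` BY NAME: (A) `hnd` + the junction data of record {`hc₀`, `ht`; `hD₁`, `hY₁`; `cnst`,
`G`, `ecn`, `hP34`}; `hF`, `hαover`; (anchor) `hcharAN`, `hdivA`; (§4) `h44`, `ψ`, `hpull`, `hii`, `h3`, `h4b`, `h8`, `h15a`, `h15`, `D N`;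
(per normalised anchor) `hsurj` (Lem. 5.8 at the discrepancy unit — GAP G-f123-1), `hcfix`, `hivPiso` (abc-iut-L2-t4 R480); (C) `hc`.
It is the (r4) successor of this seat's `…_ofThetaSettingYddFamily_ofAnchored_genuine_of_cor218_i` (p452318): `hArises`, `hebs`, the
all-units `hroot₁N` / `hivP′` and the whole `hfam` binder are gone, exactly as in '_final_v3'.
HONEST FRAMING: kernel-checked composition of landed theorems for data so parametrised (no instance of the class `TemperedFrobenioid T₀
(ConnectedPart (BTemp Π^tp_X̲̲)) VD` for an actual curve is constructed anywhere in the tree); F-0620 / `Prop15iii` are FACT-policy assumption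
labels (nothing of [EtTh] is asserted unconditionally); typed ≠ discharged — PROVED modulo the displayed binders; no side taken on anything
downstream ([IUTchIII] Cor. 3.12 in particular).
-/

noncomputable section

namespace Literature.AnabelianGeometry.EtaleTheta

open CategoryTheory Opposite Literature.AlgebraicGeometry.Frobenioids Literature.AnabelianGeometry.SemiGraphs
  Literature.AnabelianGeometry.SemiGraphs.GaloisObjects

universe v₀ u₁ v₁

namespace ThetaFrobenioidTower

section Setting

variable {p : ℕ} [Fact p.Prime] {DS : ThetaSetting p} {ES : DS.EtaleThetaData} {l' : ℕ} (Cu : ES.DoubleUnderline l')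
  {e' : DS.toTemperedCurve.GroupLevelData} {Es : Set ℕ+} (τ : DS.CyclotomeTower l' Es) (hC : DS.Compat) (hS : DS.Sec2Hyps)
  {D₀ : Type} [Category.{v₀} D₀] {V : FrdIMonoidStub.{0}} {T₀ : RealifiedDivisorMonoids (D₀ := D₀) V}
  {VD : FrdICatStub.{1, 0, 0} (ConnectedPart (BTemp (Cu.temperedArithmeticGroup e').Pi))}
  {tf : TemperedFrobenioid T₀ (ConnectedPart (BTemp (Cu.temperedArithmeticGroup e').Pi)) VD} {hZ : tf.monoidType = MonoidType.Z}
  {hP : ∀ A : (ConnectedPart (BTemp (Cu.temperedArithmeticGroup e').Pi))ᵒᵖ, IsPerfect (tf.Φ.carrier A)}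
  {NH : Subgroup (Field.absoluteGaloisGroup DS.K) → tf.category → ℕ+ → Prop}
  {pullFrac : ∀ {A A' : (BiKummerSetting.mkOfConnectedTemperoidYddTower (Cu.temperedArithmeticGroup e') tf hZ hP NH
      (Cu.thetaEnvTower τ hC hS) (ContinuousMulEquiv.refl _)).C} (_ : A' ⟶ A),
    (BiKummerSetting.mkOfConnectedTemperoidYddTower (Cu.temperedArithmeticGroup e') tf hZ hP NH (Cu.thetaEnvTower τ hC hS)
        (ContinuousMulEquiv.refl _)).biratUnits A →
      (BiKummerSetting.mkOfConnectedTemperoidYddTower (Cu.temperedArithmeticGroup e') tf hZ hP NH (Cu.thetaEnvTower τ hC hS)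
        (ContinuousMulEquiv.refl _)).biratUnits A'}
  {θ : (BiKummerSetting.mkOfConnectedTemperoidYddTower (Cu.temperedArithmeticGroup e') tf hZ hP NH (Cu.thetaEnvTower τ hC hS)
      (ContinuousMulEquiv.refl _)).biratUnits
    (BiKummerSetting.mkOfConnectedTemperoidYddTower (Cu.temperedArithmeticGroup e') tf hZ hP NH (Cu.thetaEnvTower τ hC hS)
      (ContinuousMulEquiv.refl _)).Aodot}
  {Bl : (BiKummerSetting.mkOfConnectedTemperoidYddTower (Cu.temperedArithmeticGroup e') tf hZ hP NH (Cu.thetaEnvTower τ hC hS)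
      (ContinuousMulEquiv.refl _)).C}
  {Pl : (BiKummerSetting.mkOfConnectedTemperoidYddTower (Cu.temperedArithmeticGroup e') tf hZ hP NH (Cu.thetaEnvTower τ hC hS)
      (ContinuousMulEquiv.refl _)).FractionPair θ Bl}
  {Rl : (BiKummerSetting.mkOfConnectedTemperoidYddTower (Cu.temperedArithmeticGroup e') tf hZ hP NH (Cu.thetaEnvTower τ hC hS)
      (ContinuousMulEquiv.refl _)).NthRoot θ Pl Cu.lPNat pullFrac}
  (h : ModelFrobenioid.Hypotheses tf.divisorMonoid tf.ratFnFunctor)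
  (Q : FrobenioidTheta.ThetaSubquotientStub.{0} (ConnectedPart (BTemp (Cu.temperedArithmeticGroup e').Pi)))
  (R : ∀ N : ℕ+, (BiKummerSetting.mkOfConnectedTemperoidYddTower (Cu.temperedArithmeticGroup e') tf hZ hP NH
      (Cu.thetaEnvTower τ hC hS) (ContinuousMulEquiv.refl _)).NthRoot Rl.root Rl.pair N pullFrac)
  (K' : Type) [Field K'] {X₀ : ConnectedPart (BTemp (Cu.temperedArithmeticGroup e').Pi)}
  (hX₀ : ∀ Y : ConnectedPart (BTemp (Cu.temperedArithmeticGroup e').Pi), Subsingleton (Y ⟶ X₀))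
  (t : ∀ N : ℕ+, (R N).BN.base ⟶ X₀) (c₀ : K'ˣ →* (tf.ratFnFunctor.obj (op X₀))ˣ)
  (hc₀ : Function.Injective c₀) (ht : ∀ N : ℕ+, Function.Injective (tf.ratFnFunctor.map (t N).op).hom)
  (hinvc : ∀ (N : ℕ+) (g : Aut (R N).AN.base),
    pull tf.divisorMonoid g.hom (ModelFrobenioid.div (R N).pair.num) = ModelFrobenioid.div (R N).pair.num)
  (hinvp : ∀ (N : ℕ+) (y : (Cu.thetaEnvTower τ hC hS).PiX), y ∈ (Cu.thetaEnvTower τ hC hS).PiYdd →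
    pull tf.divisorMonoid ((BiKummerSetting.mkOfConnectedTemperoidYddTower (Cu.temperedArithmeticGroup e') tf hZ hP NH
      (Cu.thetaEnvTower τ hC hS) (ContinuousMulEquiv.refl _)).galoisSurj (R N).AN.base (R N).αData.isGalois
        ((ContinuousMulEquiv.refl _) y)).hom (ModelFrobenioid.div (R N).pair.den) = ModelFrobenioid.div (R N).pair.den)
  (α : ∀ {N N' : ℕ+}, (N : ℕ) ∣ N' → ((R N').AN ⟶ (R N).AN))
  (β : ∀ {N N' : ℕ+}, (N : ℕ) ∣ N' → ((R N').BN ⟶ (R N).BN))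
  (comm_sCap : ∀ {N N' : ℕ+} (hd : (N : ℕ) ∣ N'), (R N').pair.num ≫ β hd = α hd ≫ (R N).pair.num)
  (comm_sCup : ∀ {N N' : ℕ+} (hd : (N : ℕ) ∣ N'), (R N').pair.den ≫ β hd = α hd ≫ (R N).pair.den)
  (isIsometry_α : ∀ {N N' : ℕ+} (hd : (N : ℕ) ∣ N'),
    ((BiKummerSetting.mkOfConnectedTemperoidYddTower (Cu.temperedArithmeticGroup e') tf hZ hP NH (Cu.thetaEnvTower τ hC hS)
      (ContinuousMulEquiv.refl _)).sec5Stub h).pre.IsIsometry (α hd))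
  (degFr_α : ∀ {N N' : ℕ+} (hd : (N : ℕ) ∣ N'),
    (((BiKummerSetting.mkOfConnectedTemperoidYddTower (Cu.temperedArithmeticGroup e') tf hZ hP NH (Cu.thetaEnvTower τ hC hS)
      (ContinuousMulEquiv.refl _)).sec5Stub h).pre.degFr (α hd) : ℕ) * N = N')
  (isIsometry_β : ∀ {N N' : ℕ+} (hd : (N : ℕ) ∣ N'),
    ((BiKummerSetting.mkOfConnectedTemperoidYddTower (Cu.temperedArithmeticGroup e') tf hZ hP NH (Cu.thetaEnvTower τ hC hS)
      (ContinuousMulEquiv.refl _)).sec5Stub h).pre.IsIsometry (β hd))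
  (degFr_β : ∀ {N N' : ℕ+} (hd : (N : ℕ) ∣ N'),
    (((BiKummerSetting.mkOfConnectedTemperoidYddTower (Cu.temperedArithmeticGroup e') tf hZ hP NH (Cu.thetaEnvTower τ hC hS)
      (ContinuousMulEquiv.refl _)).sec5Stub h).pre.degFr (β hd) : ℕ) * N = N')
  (baseFrob_α : ∀ {N N' : ℕ+} (hd : (N : ℕ) ∣ N'),
    (BiKummerSetting.mkOfConnectedTemperoidYddTower (Cu.temperedArithmeticGroup e') tf hZ hP NH (Cu.thetaEnvTower τ hC hS)
      (ContinuousMulEquiv.refl _)).IsOfBaseFrobeniusType (α hd))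
  -- the §4 package `h44` and its Thm. 4.4 clauses (as in '_final_v3')
  (h44 : BiKummerSetting.Thm44Hyp
    (BiKummerSetting.mkOfConnectedTemperoidYddTower (Cu.temperedArithmeticGroup e') tf hZ hP NH (Cu.thetaEnvTower τ hC hS)
      (ContinuousMulEquiv.refl _))
    (BiKummerSetting.mkOfConnectedTemperoidYddTower (Cu.temperedArithmeticGroup e') tf hZ hP NH (Cu.thetaEnvTower τ hC hS)
      (ContinuousMulEquiv.refl _)))
  (ψ : ∀ A : (BiKummerSetting.mkOfConnectedTemperoidYddTower (Cu.temperedArithmeticGroup e') tf hZ hP NH (Cu.thetaEnvTower τ hC hS)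
      (ContinuousMulEquiv.refl _)).C,
    (BiKummerSetting.mkOfConnectedTemperoidYddTower (Cu.temperedArithmeticGroup e') tf hZ hP NH (Cu.thetaEnvTower τ hC hS)
        (ContinuousMulEquiv.refl _)).biratUnits A ≃*
      (BiKummerSetting.mkOfConnectedTemperoidYddTower (Cu.temperedArithmeticGroup e') tf hZ hP NH (Cu.thetaEnvTower τ hC hS)
        (ContinuousMulEquiv.refl _)).biratUnits (h44.Ψ.functor.obj A))
  (hpull : ∀ {A A' : (BiKummerSetting.mkOfConnectedTemperoidYddTower (Cu.temperedArithmeticGroup e') tf hZ hP NH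
      (Cu.thetaEnvTower τ hC hS) (ContinuousMulEquiv.refl _)).C} (φ : A' ⟶ A)
    (f : (BiKummerSetting.mkOfConnectedTemperoidYddTower (Cu.temperedArithmeticGroup e') tf hZ hP NH (Cu.thetaEnvTower τ hC hS)
      (ContinuousMulEquiv.refl _)).biratUnits A),
      ψ A' (pullFrac φ f) = pullFrac (h44.Ψ.functor.map φ) (ψ A f))
  (hii : BiKummerSetting.Thm44_ii h44 ψ) (h3 : h44.PreservesFrobeniusStructure) (h4b : h44.PreservesBaseFrobeniusTypeData)
  (h8 : h44.PreservesAmple) (h15a : h44.PreservesFixedByHA ψ) (h15 : h44.PreservesSaturated ψ)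
  -- (B1)/(B1′): the Def. 4.1 (iv) datum of each transition `α_{1,N}`
  (D : ∀ N : ℕ+, (BiKummerSetting.mkOfConnectedTemperoidYddTower (Cu.temperedArithmeticGroup e') tf hZ hP NH (Cu.thetaEnvTower τ hC hS)
      (ContinuousMulEquiv.refl _)).BaseFrobeniusTypeData (α (one_dvd_level N)))

include hX₀ h hc₀ ht comm_sCap comm_sCup isIsometry_α degFr_α isIsometry_β degFr_β hpull hii h3 h4b h8 h15a h15 in
/-- **[EtTh] Theorem 5.7 — FINAL KNIT v3 at the tower OF THE SETTING, `hP24` ⟸ F-0620, `hYdd` a theorem**: abc-iut-w6-d077's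
`thetaRootPreservedAll_ofConnectedTemperoidYddFamily_final_v3` (p458453) at `(X, 𝒯, ιX) := (Π^tp_X̲̲, Cu.thetaEnvTower τ hC hS, id)` against
abc-iut-L2-t4's `ofThetaSettingFamily` (`rfl`), with the anchor binder `hP24` SUPPLIED by `Cu.hP24_thetaEnvTower_of_cor218_i τ hC hS μ' h15iii L
h218i` (the `Π^tp_Ÿ`-clause of the frozen FACT `RigidData.Cor218_i`, F-0620, at `Cu.rigidData μ' hC hS h15iii L`) and `hYdd` by
`hYdd_thetaEnvTower_ofThetaSetting τ hC hS`.  RESIDUAL = the displayed binders (see the module docstring); GONE vs this seat's p452318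
Setting capstone: `hArises`, `hebs`, the all-units `hroot₁N`/`hivP′`, `hfam`.
[cite: MochizukiEtTh2009, Thm 5.7 p.329–330 (PDF pp.103–104); Cor 2.18 (i) p.285–286 (PDF pp.59–60); Lem 5.8 p.331 (PDF p.105)] -/
theorem thetaRootPreservedAll_ofThetaSettingYddFamily_final_v3_of_cor218_i
    (T : ThetaFrobenioidTower.{0} (BiKummerSetting.mkOfConnectedTemperoidYddTower (Cu.temperedArithmeticGroup e') tf hZ hP NH
      (Cu.thetaEnvTower τ hC hS) (ContinuousMulEquiv.refl _)).C (ConnectedPart (BTemp (Cu.temperedArithmeticGroup e').Pi)))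
    (hT : T = ofThetaSettingFamily τ hC hS h Q R K' (fun N => (Units.map (tf.ratFnFunctor.map (t N).op).hom).comp c₀)
      (fun N => tf.unitsMap_comp_injective (t N) hc₀ (ht N)) hinvc hinvp α β comm_sCap comm_sCup isIsometry_α degFr_α
      isIsometry_β degFr_β baseFrob_α)
    -- (A), residual of record: print's standing hypothesis "`Φ` non-dilating" (Prop. 5.1 / Thm. 4.4)
    (hnd : IsNonDilatingOn tf.divisorMonoid)
    -- (A) `hgc₁` RE-KEYED (p447915): the ONE `ConstantsDictionary` junction binder at the first root + `hY₁`
    {μ₁ : DS.CyclotomeMod l' (T.atLevel 1).N} {ι₁ : (T.atLevel 1).PiX ≃ₜ* (Cu.thetaEnvData μ₁ hC hS).PiX}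
    {m₁ : (T.atLevel 1).muTorsion (T.atLevel 1).BN (T.atLevel 1).N ≃* (Cu.thetaEnvData μ₁ hC hS).mu}
    (act₁ : (T.atLevel 1).BiratAutAction) {Cst₁ : Subgroup ((T.atLevel 1).biratUnits (T.atLevel 1).BN)}
    {ν₁ : Cst₁ →* (PadicAlgCl p)ˣ}
    (hD₁ : ThetaFrobenioid.BiratAutAction.ConstantsDictionary act₁ Cu μ₁ hC hS ι₁ m₁ Cst₁ ν₁)
    (hY₁ : (T.atLevel 1).IdentifiesPiY (Cu.thetaEnvData μ₁ hC hS) ι₁.toMulEquiv)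
    -- (A) `hfac₁` RE-KEYED (p447915): Prop. 3.4 (ii) and the identification `D → D₀ → D^cnst ≅ aug_* ⋙ G` (`hYdd` is a theorem here)
    {Dcnst : Type u₁} [Category.{v₁} Dcnst] (cnst : D₀ ⥤ Dcnst)
    (G : ConnectedPart (BTemp (Field.absoluteGaloisGroup DS.K)) ⥤ Dcnst)
    (ecn : tf.base ⋙ cnst ≅ QuasiTemperoid.pushforward (Cu.temperedArithmeticGroup e').aug.toMonoidHom
      (Cu.temperedArithmeticGroup e').aug_surjective (Cu.temperedArithmeticGroup e').augIsOpenMap_holds ⋙ G)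
    (hP34 : RealifiedDivisorMonoids.Prop34Cnst T₀ cnst)
    -- the rendering law of `pullFrac`, the transitions over the base pair
    (hF : ∀ {B B' : (BiKummerSetting.mkOfConnectedTemperoidYddTower (Cu.temperedArithmeticGroup e') tf hZ hP NH
        (Cu.thetaEnvTower τ hC hS) (ContinuousMulEquiv.refl _)).C} (φ : B' ⟶ B)
      (y : (BiKummerSetting.mkOfConnectedTemperoidYddTower (Cu.temperedArithmeticGroup e') tf hZ hP NH (Cu.thetaEnvTower τ hC hS)
        (ContinuousMulEquiv.refl _)).biratUnits B), pullFrac φ y = tf.pullFracModel φ y)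
    (hαover : ∀ N : ℕ+, α (one_dvd_level N) ≫ (R 1).α = (R N).α)
    -- «`A_N^bs` characteristic in `Π^tp_X̲̲`» at EVERY level (the [EtTh] Prop. 2.4-class clause of '_final_v3'; abc-iut-w6-d077's residual)
    (hcharAN : ∀ N : ℕ+, IsTopCharacteristic (Cu.temperedArithmeticGroup e').Pi
      (galoisSurjOf (Cu.temperedArithmeticGroup e').isTempered (R N).AN.base.obj (R N).αData.isGalois).ker)
    (hdivA : ∀ αA : h44.Ψ.functor.obj (T.AN 1) ≅ T.AN 1, ∃ ε : Aut (T.AN 1),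
      T.pre.div (αA.inv ≫ h44.Ψ.functor.map (T.sCap 1)) = T.pre.div (ε.hom ≫ T.sCap 1) ∧
      T.pre.div (αA.inv ≫ h44.Ψ.functor.map (T.sCup 1)) = T.pre.div (ε.hom ≫ T.sCup 1))
    -- (anchor) `hP24` RE-KEYED to the frozen FACT F-0620 ([EtTh] Cor. 2.18 (i)) at abc-iut-L2-t8's `Cu.rigidData μ' hC hS h15iii L`
    {N' : ℕ+} (μ' : DS.CyclotomeMod l' N') (h15iii : DS.Prop15iii ES hC) (L : Cu.CuspLabels)
    (h218i : (Cu.rigidData μ' hC hS h15iii L).Cor218_i)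
    -- per NORMALISED ANCHOR `(α₁, β₁, u₁)` and level, POINTWISE (abc-iut-f-123 p455663): (L58) Lemma 5.8 AT the discrepancy unit
    -- `u₁` read on `B_N` (GAP G-f123-1), and (CFix) the `H_{A_N}`-invariance of its function pulled back to `A_N`
    (hsurj : ∀ (α₁ : h44.Ψ.functor.obj (R 1).AN ≅ (R 1).AN) (β₁ : h44.Ψ.functor.obj (R 1).BN ≅ (R 1).BN) (u₁ : Aut (R 1).BN)
      (_ : u₁ ∈ (BiKummerSetting.mkOfConnectedTemperoidYddTower (Cu.temperedArithmeticGroup e') tf hZ hP NH (Cu.thetaEnvTower τ hC hS)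
        (ContinuousMulEquiv.refl _)).units (R 1).BN),
      α₁.inv ≫ h44.Ψ.functor.map (R 1).pair.num ≫ β₁.hom = (R 1).pair.num →
      α₁.inv ≫ h44.Ψ.functor.map (R 1).pair.den ≫ β₁.hom = (R 1).pair.den ≫ u₁.hom →
      ∀ (N : ℕ+), ∃ r : tf.biratUnitsModel (R N).BN, (r : tf.ratFnFunctor.obj (op (R N).BN.base)) ^ (N : ℕ) =
        (tf.ratFnFunctor.map (ModelFrobenioid.baseMap (β (one_dvd_level N))).op).hom (ModelFrobenioid.unit u₁.hom))
    (hcfix : ∀ (α₁ : h44.Ψ.functor.obj (R 1).AN ≅ (R 1).AN) (β₁ : h44.Ψ.functor.obj (R 1).BN ≅ (R 1).BN) (u₁ : Aut (R 1).BN)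
      (_ : u₁ ∈ (BiKummerSetting.mkOfConnectedTemperoidYddTower (Cu.temperedArithmeticGroup e') tf hZ hP NH (Cu.thetaEnvTower τ hC hS)
        (ContinuousMulEquiv.refl _)).units (R 1).BN),
      α₁.inv ≫ h44.Ψ.functor.map (R 1).pair.num ≫ β₁.hom = (R 1).pair.num →
      α₁.inv ≫ h44.Ψ.functor.map (R 1).pair.den ≫ β₁.hom = (R 1).pair.den ≫ u₁.hom →
      ∀ (N : ℕ+), (BiKummerSetting.mkOfConnectedTemperoidYddTower (Cu.temperedArithmeticGroup e') tf hZ hP NH (Cu.thetaEnvTower τ hC hS)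
          (ContinuousMulEquiv.refl _)).IsFixedByHA (R N).AN (R N).isSaturated.isAmple.isGalois
        (pullFrac (D N).α₁ (pullFrac (R 1).pair.den
          (tf.isUnit_ratFnFunctor T₀.isUnit_BΛ (R 1).BN (ModelFrobenioid.unit u₁.hom)).unit)))
    -- Prop. 4.2 (iv) at the `u₁`-twisted level-1 pair, per NORMALISED ANCHOR, ACROSS an isomorphism of pairs ((r4); abc-iut-L2-t4 R480)
    (hivPiso : ∀ (α₁ : h44.Ψ.functor.obj (R 1).AN ≅ (R 1).AN) (β₁ : h44.Ψ.functor.obj (R 1).BN ≅ (R 1).BN) (u₁ : Aut (R 1).BN)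
      (hu₁ : u₁ ∈ (BiKummerSetting.mkOfConnectedTemperoidYddTower (Cu.temperedArithmeticGroup e') tf hZ hP NH (Cu.thetaEnvTower τ hC hS)
        (ContinuousMulEquiv.refl _)).units (R 1).BN),
      α₁.inv ≫ h44.Ψ.functor.map (R 1).pair.num ≫ β₁.hom = (R 1).pair.num →
      α₁.inv ≫ h44.Ψ.functor.map (R 1).pair.den ≫ β₁.hom = (R 1).pair.den ≫ u₁.hom →
      ∀ (N : ℕ+) {A₂ B₂ : (BiKummerSetting.mkOfConnectedTemperoidYddTower (Cu.temperedArithmeticGroup e') tf hZ hP NH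
        (Cu.thetaEnvTower τ hC hS) (ContinuousMulEquiv.refl _)).C}
      {f₂ : (BiKummerSetting.mkOfConnectedTemperoidYddTower (Cu.temperedArithmeticGroup e') tf hZ hP NH (Cu.thetaEnvTower τ hC hS)
        (ContinuousMulEquiv.refl _)).biratUnits A₂}
      {P₂ : (BiKummerSetting.mkOfConnectedTemperoidYddTower (Cu.temperedArithmeticGroup e') tf hZ hP NH (Cu.thetaEnvTower τ hC hS)
        (ContinuousMulEquiv.refl _)).FractionPair f₂ B₂}
      (R' : (BiKummerSetting.mkOfConnectedTemperoidYddTower (Cu.temperedArithmeticGroup e') tf hZ hP NH (Cu.thetaEnvTower τ hC hS)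
          (ContinuousMulEquiv.refl _)).NthRoot
        ((BiKummerSetting.mkOfConnectedTemperoidYddTower (Cu.temperedArithmeticGroup e') tf hZ hP NH (Cu.thetaEnvTower τ hC hS)
            (ContinuousMulEquiv.refl _)).fracOf (R 1).pair.num ((R 1).pair.den ≫ u₁.hom) (R 1).pair.isPreStep_num
          ((BiKummerSetting.mkOfConnectedTemperoidYddTower (Cu.temperedArithmeticGroup e') tf hZ hP NH (Cu.thetaEnvTower τ hC hS)
            (ContinuousMulEquiv.refl _)).isPreStep_comp_aut (R 1).pair.isPreStep_den u₁)
          ((BiKummerSetting.mkOfConnectedTemperoidYddTower (Cu.temperedArithmeticGroup e') tf hZ hP NH (Cu.thetaEnvTower τ hC hS)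
            (ContinuousMulEquiv.refl _)).baseEquivalent_comp_unit (R 1).pair.base_eq hu₁))
        ((R 1).pair.twistUnit u₁ hu₁ rfl (BiKummerSetting.disjointSupports_twistUnit h.isDivisorial (R 1).pair u₁)) N pullFrac)
      (R₂ : (BiKummerSetting.mkOfConnectedTemperoidYddTower (Cu.temperedArithmeticGroup e') tf hZ hP NH (Cu.thetaEnvTower τ hC hS)
        (ContinuousMulEquiv.refl _)).NthRoot f₂ P₂ N pullFrac)
      (eA : A₂ ≅ (R 1).AN) (eB : B₂ ≅ (R 1).BN),
      eA.inv ≫ P₂.num ≫ eB.hom = (R 1).pair.num → eA.inv ≫ P₂.den ≫ eB.hom = (R 1).pair.den ≫ u₁.hom →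
      pullFrac eA.hom
          ((BiKummerSetting.mkOfConnectedTemperoidYddTower (Cu.temperedArithmeticGroup e') tf hZ hP NH (Cu.thetaEnvTower τ hC hS)
              (ContinuousMulEquiv.refl _)).fracOf (R 1).pair.num ((R 1).pair.den ≫ u₁.hom) (R 1).pair.isPreStep_num
            ((BiKummerSetting.mkOfConnectedTemperoidYddTower (Cu.temperedArithmeticGroup e') tf hZ hP NH (Cu.thetaEnvTower τ hC hS)
              (ContinuousMulEquiv.refl _)).isPreStep_comp_aut (R 1).pair.isPreStep_den u₁)
            ((BiKummerSetting.mkOfConnectedTemperoidYddTower (Cu.temperedArithmeticGroup e') tf hZ hP NH (Cu.thetaEnvTower τ hC hS)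
              (ContinuousMulEquiv.refl _)).baseEquivalent_comp_unit (R 1).pair.base_eq hu₁)) = f₂ →
      ∀ (ebs : (BiKummerSetting.mkOfConnectedTemperoidYddTower (Cu.temperedArithmeticGroup e') tf hZ hP NH (Cu.thetaEnvTower τ hC hS)
          (ContinuousMulEquiv.refl _)).base.obj R'.AN ≅
        (BiKummerSetting.mkOfConnectedTemperoidYddTower (Cu.temperedArithmeticGroup e') tf hZ hP NH (Cu.thetaEnvTower τ hC hS)
          (ContinuousMulEquiv.refl _)).base.obj R₂.AN),
      (BiKummerSetting.mkOfConnectedTemperoidYddTower (Cu.temperedArithmeticGroup e') tf hZ hP NH (Cu.thetaEnvTower τ hC hS)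
          (ContinuousMulEquiv.refl _)).base.map R'.α =
        ebs.hom ≫ (BiKummerSetting.mkOfConnectedTemperoidYddTower (Cu.temperedArithmeticGroup e') tf hZ hP NH (Cu.thetaEnvTower τ hC hS)
          (ContinuousMulEquiv.refl _)).base.map (R₂.α ≫ eA.hom) →
        ∃ (v : (BiKummerSetting.mkOfConnectedTemperoidYddTower (Cu.temperedArithmeticGroup e') tf hZ hP NH (Cu.thetaEnvTower τ hC hS)
            (ContinuousMulEquiv.refl _)).mu R'.BN N) (ζA : R'.AN ≅ R₂.AN) (ζB : R'.BN ≅ R₂.BN),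
          ζA.hom ≫ R₂.pair.num = R'.pair.num ≫ ζB.hom ∧
          ζA.hom ≫ R₂.pair.den = (R'.pair.den ≫ (v : Aut R'.BN).hom) ≫ ζB.hom ∧
          ζA.hom ≫ R₂.α ≫ eA.hom = R'.α ∧ ζB.hom ≫ R₂.β ≫ eB.hom = R'.β ∧
          (BiKummerSetting.mkOfConnectedTemperoidYddTower (Cu.temperedArithmeticGroup e') tf hZ hP NH (Cu.thetaEnvTower τ hC hS)
            (ContinuousMulEquiv.refl _)).base.mapIso ζA = ebs)
    -- (C): the level-1 discrepancy constant of every normalised transport is a `2l`-th root of unity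
    (hc : ∀ (α₁ : h44.Ψ.functor.obj (T.AN 1) ≅ T.AN 1) (β₁ : h44.Ψ.functor.obj (T.BN 1) ≅ T.BN 1) (u₁ : Aut (T.BN 1))
      (hu₁ : u₁ ∈ (T.atLevel 1).units (T.BN 1)),
      α₁.inv ≫ h44.Ψ.functor.map (T.sCap 1) ≫ β₁.hom = T.sCap 1 →
      α₁.inv ≫ h44.Ψ.functor.map (T.sCup 1) ≫ β₁.hom = T.sCup 1 ≫ u₁.hom →
        ∀ c : T.Kˣ, (T.atLevel 1).unitsToBirat (T.BN 1) ⟨u₁, hu₁⟩ = T.constEmb 1 c → c ^ (2 * T.l) = 1) :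
    T.ThetaRootPreservedAll h44.Ψ :=
  -- (`𝒯 := Cu.thetaEnvTower τ hC hS`, `ιX := id` are read off the type of `R`; passing `ContinuousMulEquiv.refl _` explicitly
  -- before `X` is determined makes the unifier normalise `Π^tp_X̲̲` and time out — cf. p448710)
  thetaRootPreservedAll_ofConnectedTemperoidYddFamily_final_v3 _ _ h Q Cu.odd_lPNat R K' hX₀ t c₀ hc₀ ht hinvc hinvp α β comm_sCap
    comm_sCup isIsometry_α degFr_α isIsometry_β degFr_β baseFrob_α Cu hC hS h44 ψ hpull hii h3 h4b h8 h15a h15 D T hT hnd act₁ hD₁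
    hY₁ cnst G ecn hP34 (hYdd_thetaEnvTower_ofThetaSetting τ hC hS) hF hαover hcharAN hdivA
    (Cu.hP24_thetaEnvTower_of_cor218_i τ hC hS μ' h15iii L h218i) hsurj hcfix hivPiso hc

end Setting

end ThetaFrobenioidTower

end Literature.AnabelianGeometry.EtaleTheta

end
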